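import Literature.NumberTheory.EllipticCurves.CongruentNumberOddMonskySelmerLocal
import Literature.NumberTheory.EllipticCurves.CongruentNumberEvenMonskySelmerBound
import HarnessLib

/-!
# Monsky's `2`-Selmer formula for `E_{p₁⋯p_k} : y² = x³ − (p₁⋯p_k)²x` (ODD `n`), UPPER-BOUND HALF, for every `k`

Topic `NumberTheory/EllipticCurves`; namespace
`Literature.NumberTheory.EllipticCurves.CongruentNumberOddMonskySelmer`. A pure proof file (theorems only);
part 2 of 2 for odd `n` (part 1: `CongruentNumberOddMonskySelmerLocal.lean`; the even twin:
`CongruentNumberEvenMonskySelmerBound.lean`).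

The appendix of P. Monsky to Heath-Brown, Invent. Math. 118 (1994), ODD case (typescript p. 38 L17 – p. 39 L33,
with full proof in print): for `D = p₁⋯p_k` odd square-free, `#S⁽²⁾(E_D/ℚ) = 2^{2+s(D)}`, `2^{s(D)} = #ker M`,
`M = ( A + D₂  D₂ ; D₂  A + D₋₂ )` (`A_ij = [(pⱼ/pᵢ) = −1]`, `A_ii = Σ_{j≠i} A_ij`, `D_m = diag [(m/pᵢ) = −1]`), i.e.
`s(D) = 2k − rank M`. The tree vendors this as the NAMED FACT `HeathBrown1994.monsky_card_selmerGroup_two_odd`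
(`monskyMatrixOdd p`, `monskySelmerRankOdd p`). THIS FILE PROVES THE UPPER BOUND, UNCONDITIONALLY, UNIFORMLY IN `k`:

  `card_selmerGroup_two_le_pow_monskySelmerRankOdd :
     (∀ i, (p i).Prime) → (∀ i, Odd (p i)) → Function.Injective p →
       Nat.card ((congruentNumberCurve (∏ i, p i)).selmerGroup 2) ≤ 2 ^ (2 + monskySelmerRankOdd p)`

— the `≤` half of the named fact in its binders (the `≥` half, local solubility of the `2^s` systems (30), is not
touched; the cell's odd-class doors `P2/CongruentNumberOddAokiMonsky*` use only `#Sel₂ ≤ 2^{2+s}`).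

## The proof (complete `2`-descent on SELMER classes through the tree's descent–Selmer bridge)

`E_n : y² = (x + n)·x·(x − n)`, `n = p₁⋯p_k` odd, components `[a]` (`x + n`), `[b]` (`x`) of `c ∈ Sel⁽²⁾(E_n/ℚ)` (part 1):
`a > 0`; `a`, `b` of even valuation at the odd primes off `{pᵢ}`; **`v₂(b)` even** (`2` is a good place for the
`T₂`-model: `v₂(0 − (∓n)) = 0`); at `pᵢ`: `qrᵢ(a) = αᵢA_ii + βᵢ[2]ᵢ`, `qrᵢ(b) = αᵢ[−1]ᵢ + βᵢ([−1]ᵢ + A_ii)`.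
NORMALISE by the character `ν = (v₂(a), sign(b)) : Sel⁽²⁾ → (ℤ/2)²` (kernel `K` of index `≤ 4`; Monsky's "`a` and `b`
are arbitrary POSITIVE divisors of `D`" for his `a ~ x + n` (ours) and `b ~ x − n ~` our `a·b`, p. 38 L22–L23). On `K` the
expansions read `qrᵢ(a) = Σ_{j≠i} A_ij αⱼ`, `qrᵢ(b) = Σ_{j≠i} A_ij βⱼ`, and in Monsky's variables `x = α`
(`xᵢ = [pᵢ ∣ a_M]`), `y = α + β` (`x_{i+k} = [pᵢ ∣ b_M]`, `b_M ~ (x+n)·x`): the relation for `a` is row `i` of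
`(A + D₂)x + D₂y = 0` and the SUM of the two relations is row `i` of `D₂x + (A + D₋₂)y = 0` (`[−2] = [−1] + [2]`),
i.e. `(x; y) ∈ ker M` (§2, `monskyMatrixOdd_mulVec_eq_zero`). On `K` the map `c ↦ (x; y)` is injective (§3). Hence
`#Sel⁽²⁾ ≤ [Sel⁽²⁾ : K]·#K ≤ 4·#ker M = 2^{2 + s(n)}` (§4). No quadratic reciprocity is needed in the odd case.

Cell `bsd-monsky` (prover-B): with this file Monsky's formula leaves the odd-class record too
(`P2/CongruentNumberOddAokiMonsky*`: Aoki = Monsky on `n ≡ 3, 7 (mod 8)`). Everything is proved; no named facts;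
nothing about any class is booked here.

## References

* [HeathBrown1994SelmerCongruentII] D. R. Heath-Brown, *The size of Selmer groups for the congruent number
  problem, II*, with an appendix by P. Monsky, Invent. Math. 118 (1994) 331–370: §1 (typescript p. 1 L14–L20);
  Appendix p. 38 L17–L37, p. 39 L1–L33.
* [SilvermanAEC2009] J. H. Silverman, *The Arithmetic of Elliptic Curves*, 2nd ed., GTM 106, Springer 2009,
  Prop. X.1.4, Thm. X.1.1(c), Prop. X.4.9.
-/

noncomputable section

open scoped Classical

open WeierstrassCurve WeierstrassCurve.Affine WeierstrassCurve.Affine.Point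
open Literature.NumberTheory.GaloisRepresentations
open Literature.NumberTheory.EllipticCurves.KramerTwoDescent
open Literature.NumberTheory.EllipticCurves.TwoDescentLocal
open IsDedekindDomain NumberField Rat.HeightOneSpectrum
open Literature.NumberTheory.EllipticCurves.HeathBrown1994
open Matrix

namespace Literature.NumberTheory.EllipticCurves

namespace CongruentNumberOddMonskySelmer

open CongruentNumberEvenMonskySelmer

variable {k : ℕ} {p : Fin k → ℕ}

/-- `∏ pᵢ ≠ 0`. [folklore] -/
private theorem prod_ne_zero (hp : ∀ i, (p i).Prime) : ∏ i, p i ≠ 0 :=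
  Finset.prod_ne_zero_iff.mpr fun i _ => (hp i).ne_zero

/-- `2 = 0` in `ℤ/2`. [folklore] -/
private theorem two_eq_zero_zmod2 : (2 : ZMod 2) = 0 := by decide

/-! ## §1 Monsky's odd matrix acting on a vector (bookkeeping) -/

/-- The two block rows of Monsky's odd matrix `M = ( A + D₂  D₂ ; D₂  A + D₋₂ )` applied to `(x; y)`.
[cite: HeathBrown1994SelmerCongruentII, Appendix (Monsky), typescript p. 39 L27–L32] -/
theorem monskyMatrixOdd_mulVec_apply (x y : Fin k → ZMod 2) (i : Fin k) :
    (monskyMatrixOdd p *ᵥ Sum.elim x y) (Sum.inl i) =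
        ((∑ l ∈ Finset.univ.erase i, addLegendreSym (p l) (p i)) * x i +
            ∑ j ∈ Finset.univ.erase i, addLegendreSym (p j) (p i) * x j) +
          addLegendreSym 2 (p i) * x i + addLegendreSym 2 (p i) * y i ∧
      (monskyMatrixOdd p *ᵥ Sum.elim x y) (Sum.inr i) =
        addLegendreSym 2 (p i) * x i +
          (((∑ l ∈ Finset.univ.erase i, addLegendreSym (p l) (p i)) * y i +
              ∑ j ∈ Finset.univ.erase i, addLegendreSym (p j) (p i) * y j) +
            addLegendreSym (-2) (p i) * y i) := by
  rw [monskyMatrixOdd, Matrix.fromBlocks_mulVec, Sum.elim_comp_inl, Sum.elim_comp_inr]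
  refine ⟨?_, ?_⟩
  · simp only [Sum.elim_inl, Pi.add_apply, Matrix.add_mulVec, legendreMatrix_mulVec_apply,
      legendreDiagonal_mulVec_apply]
  · simp only [Sum.elim_inr, Pi.add_apply, Matrix.add_mulVec, legendreMatrix_mulVec_apply,
      legendreDiagonal_mulVec_apply]

/-! ## §2 Monsky's odd matrix kills the normalised coordinates of a Selmer class -/

variable [hE : (congruentNumberCurve (∏ i, p i)).IsElliptic]
variable (hT : (congruentNumberCurve (∏ i, p i)).toAffine.SplitTwoTorsion
  (-((∏ i, p i : ℕ) : ℚ)) 0 ((∏ i, p i : ℕ) : ℚ))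

/-- **Monsky's odd matrix annihilates the coordinates of a normalised Selmer class.** Let `c ∈ Sel⁽²⁾(E_n/ℚ)`,
`n = p₁⋯p_k` odd, with components `[a]` (`x + n`) and `[b]` (`x`), normalised by `v₂(a)` even and `b > 0`. Then
`(x; y) = (v_{pᵢ}(a) ; v_{pᵢ}(a) + v_{pᵢ}(b)) (mod 2)` — Monsky's `xᵢ = [pᵢ ∣ a]`, `x_{i+k} = [pᵢ ∣ b]` for his positive
divisors `a ~ x + n`, `b ~ (x + n)x ~ x − n` — lies in `ker M`, `M = ( A + D₂  D₂ ; D₂  A + D₋₂ )`: the first block row is the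
`I₀*` relation for `a` at each `pᵢ`, the second is the sum of the relations for `a` and for `b`.
[cite: HeathBrown1994SelmerCongruentII, Appendix (Monsky), typescript p. 38 L24 – p. 39 L33]
[cite: SilvermanAEC2009, Prop. X.1.4, Prop. X.4.9] -/
theorem monskyMatrixOdd_mulVec_eq_zero (hp : ∀ i, (p i).Prime) (hp2 : ∀ i, p i ≠ 2)
    (hinj : Function.Injective p) {c : galH1Torsion (congruentNumberCurve (∏ i, p i)) 2}
    (hc : c ∈ (congruentNumberCurve (∏ i, p i)).selmerGroup 2) (a b : ℚˣ)
    (ha : kummerEquiv ℚ 2 ((congruentNumberCurve (∏ i, p i)).twoTorsionCharH1 hT c) =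
      Additive.ofMul (QuotientGroup.mk a))
    (hb : kummerEquiv ℚ 2 ((congruentNumberCurve (∏ i, p i)).twoTorsionCharH1 hT.swap₁₂ c) =
      Additive.ofMul (QuotientGroup.mk b))
    (ha2 : parityBit 2 (a : ℚ) = 0) (hsb : signBit (b : ℚ) = 0) :
    monskyMatrixOdd p *ᵥ Sum.elim (fun i => parityBit (p i) (a : ℚ))
      (fun i => parityBit (p i) (a : ℚ) + parityBit (p i) (b : ℚ)) = 0 := by
  haveI : Fact (Nat.Prime 2) := ⟨Nat.prime_two⟩
  have ha0 : (a : ℚ) ≠ 0 := a.ne_zero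
  have hb0 : (b : ℚ) ≠ 0 := b.ne_zero
  have hev : ∀ r : ℕ, r.Prime → r ≠ 2 → (∀ j, p j ≠ r) →
      Even (padicValRat r (a : ℚ)) ∧ Even (padicValRat r (b : ℚ)) := fun r hr hr2 hrp =>
    even_padicValRat_of_mem hT hp hinj hc a b ha hb hr hr2 hrp
  have hsa : signBit (a : ℚ) = 0 := (signBit_eq_zero_iff ha0).mpr (pos_of_mem hT hp hc a ha)
  have hb2 : parityBit 2 (b : ℚ) = 0 :=
    parityBit_eq_zero_iff.mpr (even_padicValRat_two_of_mem hT hp hp2 hinj hc b hb)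
  funext s
  rcases s with i | i
  · obtain ⟨E1, -⟩ := monskyMatrixOdd_mulVec_apply (p := p) (fun i => parityBit (p i) (a : ℚ))
      (fun i => parityBit (p i) (a : ℚ) + parityBit (p i) (b : ℚ)) i
    rw [Pi.zero_apply, E1]
    obtain ⟨R1, -⟩ := qrBit_rel_of_mem hT hp hp2 hinj hc a b ha hb i
    have Xa := qrBit_expand hp hp2 hinj i ha0 fun r hr hr2 hrp => (hev r hr hr2 hrp).1
    rw [hsa, ha2] at Xa
    simp only [zero_mul, mul_zero, zero_add] at Xa
    set Aii := ∑ l ∈ Finset.univ.erase i, addLegendreSym (p l) (p i) with hAii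
    set SAa := ∑ j ∈ Finset.univ.erase i, addLegendreSym (p j) (p i) * parityBit (p j) (a : ℚ) with hSAa
    linear_combination Xa - R1 + (SAa + addLegendreSym 2 (p i) * parityBit (p i) (a : ℚ)) * two_eq_zero_zmod2
  · obtain ⟨-, E2⟩ := monskyMatrixOdd_mulVec_apply (p := p) (fun i => parityBit (p i) (a : ℚ))
      (fun i => parityBit (p i) (a : ℚ) + parityBit (p i) (b : ℚ)) i
    rw [Pi.zero_apply, E2]
    obtain ⟨R1, R2⟩ := qrBit_rel_of_mem hT hp hp2 hinj hc a b ha hb i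
    have Xa := qrBit_expand hp hp2 hinj i ha0 fun r hr hr2 hrp => (hev r hr hr2 hrp).1
    have Xb := qrBit_expand hp hp2 hinj i hb0 fun r hr hr2 hrp => (hev r hr hr2 hrp).2
    rw [hsa, ha2] at Xa
    rw [hsb, hb2] at Xb
    simp only [zero_mul, mul_zero, zero_add] at Xa Xb
    have hsum : ∑ j ∈ Finset.univ.erase i,
        addLegendreSym (p j) (p i) * (parityBit (p j) (a : ℚ) + parityBit (p j) (b : ℚ)) =
        ∑ j ∈ Finset.univ.erase i, addLegendreSym (p j) (p i) * parityBit (p j) (a : ℚ) +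
          ∑ j ∈ Finset.univ.erase i, addLegendreSym (p j) (p i) * parityBit (p j) (b : ℚ) := by
      rw [← Finset.sum_add_distrib]
      exact Finset.sum_congr rfl fun j _ => mul_add _ _ _
    rw [hsum, addLegendreSym_neg_two (hp i) (hp2 i)]
    set Aii := ∑ l ∈ Finset.univ.erase i, addLegendreSym (p l) (p i) with hAii
    set SAa := ∑ j ∈ Finset.univ.erase i, addLegendreSym (p j) (p i) * parityBit (p j) (a : ℚ) with hSAa
    set SAb := ∑ j ∈ Finset.univ.erase i, addLegendreSym (p j) (p i) * parityBit (p j) (b : ℚ) with hSAb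
    linear_combination Xa - R1 + Xb - R2 +
      (addLegendreSym 2 (p i) * parityBit (p i) (a : ℚ) + SAa + SAb) * two_eq_zero_zmod2

/-! ## §3 The normalised coordinates are injective -/

/-- **Injectivity.** A Selmer class of `E_n` (`n` odd) with `v₂(a)` even, `b > 0` and all `v_{pᵢ}(a)`, `v_{pᵢ}(b)` even is
`0`: `a > 0` (real place), `v₂(b)` is even (the place `2` is good for `b`), so all valuations of `a`, `b` are even and both
are squares; `(H¹(χ₁), H¹(χ₂))` is injective. [cite: SilvermanAEC2009, Prop. X.1.4, Thm. X.1.1(c)] -/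
theorem eq_zero_of_coords_eq_zero (hp : ∀ i, (p i).Prime) (hp2 : ∀ i, p i ≠ 2) (hinj : Function.Injective p)
    {c : galH1Torsion (congruentNumberCurve (∏ i, p i)) 2}
    (hc : c ∈ (congruentNumberCurve (∏ i, p i)).selmerGroup 2) (a b : ℚˣ)
    (ha : kummerEquiv ℚ 2 ((congruentNumberCurve (∏ i, p i)).twoTorsionCharH1 hT c) =
      Additive.ofMul (QuotientGroup.mk a))
    (hb : kummerEquiv ℚ 2 ((congruentNumberCurve (∏ i, p i)).twoTorsionCharH1 hT.swap₁₂ c) =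
      Additive.ofMul (QuotientGroup.mk b))
    (ha2 : parityBit 2 (a : ℚ) = 0) (hsb : signBit (b : ℚ) = 0) (hα : ∀ i, parityBit (p i) (a : ℚ) = 0)
    (hβ : ∀ i, parityBit (p i) (b : ℚ) = 0) : c = 0 := by
  haveI : Fact (Nat.Prime 2) := ⟨Nat.prime_two⟩
  have ha0 : (a : ℚ) ≠ 0 := a.ne_zero
  have hb0 : (b : ℚ) ≠ 0 := b.ne_zero
  have hev : ∀ r : ℕ, r.Prime → r ≠ 2 → (∀ j, p j ≠ r) →
      Even (padicValRat r (a : ℚ)) ∧ Even (padicValRat r (b : ℚ)) := fun r hr hr2 hrp =>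
    even_padicValRat_of_mem hT hp hinj hc a b ha hb hr hr2 hrp
  have hapos : 0 < (a : ℚ) := pos_of_mem hT hp hc a ha
  have hbpos : 0 < (b : ℚ) := (signBit_eq_zero_iff hb0).mp hsb
  have hb2 : Even (padicValRat 2 (b : ℚ)) := even_padicValRat_two_of_mem hT hp hp2 hinj hc b hb
  have hall : ∀ r : ℕ, r.Prime → Even (padicValRat r (a : ℚ)) ∧ Even (padicValRat r (b : ℚ)) := by
    intro r hr
    by_cases hr2 : r = 2
    · subst hr2; exact ⟨parityBit_eq_zero_iff.mp ha2, hb2⟩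
    by_cases hrp : ∃ j, p j = r
    · obtain ⟨j, rfl⟩ := hrp
      exact ⟨parityBit_eq_zero_iff.mp (hα j), parityBit_eq_zero_iff.mp (hβ j)⟩
    · exact hev r hr hr2 fun j h => hrp ⟨j, h⟩
  have hsa : sqClass (a : ℚ) = 1 := sqClass_eq_one_of_forall ha0 hapos fun r hr => (hall r hr).1
  have hsb' : sqClass (b : ℚ) = 1 := sqClass_eq_one_of_forall hb0 hbpos fun r hr => (hall r hr).2
  rw [CongruentNumberTwicePrimePairSelmer.mk_eq_sqClass, hsa, ofMul_one] at ha
  rw [CongruentNumberTwicePrimePairSelmer.mk_eq_sqClass, hsb', ofMul_one] at hb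
  exact (congruentNumberCurve (∏ i, p i)).eq_zero_of_twoTorsionCharH1_eq_zero hT c
    ((AddEquiv.map_eq_zero_iff _).mp ha) ((AddEquiv.map_eq_zero_iff _).mp hb)

/-! ## §4 The count: `#Sel⁽²⁾(E_n/ℚ) ≤ 4 · #ker M = 2^{2 + s(n)}` -/

omit hE in
/-- **Monsky's `2`-Selmer formula for odd `n`, upper-bound half, for every number of prime factors**: for distinct
odd primes `p₁, …, p_k` and `n = p₁⋯p_k`, `#Sel⁽²⁾(E_n/ℚ) ≤ 2^{2 + s(n)}`, `s(n) = 2k − rank_{𝔽₂} M`,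
`M = ( A + D₂  D₂ ; D₂  A + D₋₂ )` (`HeathBrown1994.monskyMatrixOdd`, `monskySelmerRankOdd`). Proof: the character
`ν = (v₂(a), sign(b)) : Sel⁽²⁾ → (ℤ/2)²` has kernel of index `≤ 4`, and on `ker ν` the coordinates `(α; α + β)` are an injection
into `ker M` (§2, §3); `#ker M = 2^{2k − rank M}`. The `≥` half is not proved here.
[cite: HeathBrown1994SelmerCongruentII, Appendix (Monsky), typescript p. 38 L17 – p. 39 L33; §1 p. 1 L14–L20]
[cite: SilvermanAEC2009, Prop. X.1.4, Prop. X.4.9] -/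
theorem card_selmerGroup_two_le_pow (hp : ∀ i, (p i).Prime) (hp2 : ∀ i, p i ≠ 2)
    (hinj : Function.Injective p) :
    Nat.card ((congruentNumberCurve (∏ i, p i)).selmerGroup 2) ≤ 2 ^ (2 + monskySelmerRankOdd p) := by
  haveI := isElliptic_congruentNumberCurve (prod_ne_zero hp)
  haveI : Fact (Nat.Prime 2) := ⟨Nat.prime_two⟩
  haveI : ∀ i, Fact (p i).Prime := fun i => ⟨hp i⟩
  have hT := splitTwoTorsion_cn (∏ i, p i)
  set W := congruentNumberCurve (∏ i, p i) with hW
  -- the two components, the normalising character `ν` and the coordinates `ψ`, as additive maps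
  obtain ⟨F₁, hF₁⟩ : ∃ F₁ : galH1Torsion W 2 →+ Additive (SqUnits ℚ),
      ∀ c, F₁ c = kummerEquiv ℚ 2 (W.twoTorsionCharH1 hT c) :=
    ⟨(kummerEquiv ℚ 2).toAddMonoidHom.comp (W.twoTorsionCharH1 hT), fun c => rfl⟩
  obtain ⟨F₂, hF₂⟩ : ∃ F₂ : galH1Torsion W 2 →+ Additive (SqUnits ℚ),
      ∀ c, F₂ c = kummerEquiv ℚ 2 (W.twoTorsionCharH1 hT.swap₁₂ c) :=
    ⟨(kummerEquiv ℚ 2).toAddMonoidHom.comp (W.twoTorsionCharH1 hT.swap₁₂), fun c => rfl⟩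
  obtain ⟨ν, hν⟩ : ∃ ν : galH1Torsion W 2 →+ ZMod 2 × ZMod 2,
      ∀ c, ν c = (parityHom 2 (F₁ c), signHom (F₂ c)) :=
    ⟨((parityHom 2).comp F₁).prod (signHom.comp F₂), fun c => rfl⟩
  obtain ⟨ψ, hψ⟩ : ∃ ψ : galH1Torsion W 2 →+ (Fin k ⊕ Fin k → ZMod 2), ∀ c,
      ψ c = Sum.elim (fun i => parityHom (p i) (F₁ c)) (fun i => parityHom (p i) (F₁ c) + parityHom (p i) (F₂ c)) :=
    ⟨AddMonoidHom.pi fun s => Sum.elim (fun i => (parityHom (p i)).comp F₁)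
        (fun i => (parityHom (p i)).comp F₁ + (parityHom (p i)).comp F₂) s,
      fun c => by funext s; rcases s with i | i <;> rfl⟩
  -- representatives and the values of `ν`, `ψ` on them
  have hrep : ∀ c : galH1Torsion W 2, ∃ a b : ℚˣ,
      kummerEquiv ℚ 2 (W.twoTorsionCharH1 hT c) = Additive.ofMul (QuotientGroup.mk a) ∧
      kummerEquiv ℚ 2 (W.twoTorsionCharH1 hT.swap₁₂ c) = Additive.ofMul (QuotientGroup.mk b) ∧
      ν c = (parityBit 2 (a : ℚ), signBit (b : ℚ)) ∧
      ψ c = Sum.elim (fun i => parityBit (p i) (a : ℚ)) (fun i => parityBit (p i) (a : ℚ) + parityBit (p i) (b : ℚ)) := by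
    intro c
    obtain ⟨a, ha⟩ := QuotientGroup.mk_surjective (Additive.toMul (F₁ c))
    obtain ⟨b, hb⟩ := QuotientGroup.mk_surjective (Additive.toMul (F₂ c))
    have ha' : F₁ c = Additive.ofMul (QuotientGroup.mk a) := by rw [ha, ofMul_toMul]
    have hb' : F₂ c = Additive.ofMul (QuotientGroup.mk b) := by rw [hb, ofMul_toMul]
    refine ⟨a, b, (hF₁ c).symm.trans ha', (hF₂ c).symm.trans hb', ?_, ?_⟩
    · rw [hν c, ha', hb', CongruentNumberTwicePrimePairSelmer.mk_eq_sqClass,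
        CongruentNumberTwicePrimePairSelmer.mk_eq_sqClass, parityHom_sqClass a.ne_zero, signHom_sqClass b.ne_zero]
    · rw [hψ c, ha', hb', CongruentNumberTwicePrimePairSelmer.mk_eq_sqClass,
        CongruentNumberTwicePrimePairSelmer.mk_eq_sqClass]
      congr 1 <;> funext i
      · exact parityHom_sqClass (Units.ne_zero _)
      · rw [parityHom_sqClass (Units.ne_zero _), parityHom_sqClass (Units.ne_zero _)]
  -- `ν` restricted to the Selmer group; its kernel `K` has index `≤ 4`
  set νS : W.selmerGroup 2 →+ ZMod 2 × ZMod 2 := ν.comp (W.selmerGroup 2).subtype with hνS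
  have hidx : νS.ker.index ≤ 4 := by
    rw [AddSubgroup.index_ker]
    calc Nat.card νS.range ≤ Nat.card (ZMod 2 × ZMod 2) :=
          Nat.card_le_card_of_injective _ νS.range.subtype_injective
      _ = 4 := by rw [Nat.card_prod, Nat.card_zmod]
  have hmul := νS.ker.card_mul_index
  -- on `K` the coordinates inject into `ker M`
  have hkill : ∀ c : νS.ker, ψ ((c : W.selmerGroup 2) : galH1Torsion W 2) ∈
      LinearMap.ker (monskyMatrixOdd p).mulVecLin := by
    intro c
    obtain ⟨a, b, ha, hb, hνc, hψc⟩ := hrep c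
    have h0 : ν ((c : W.selmerGroup 2) : galH1Torsion W 2) = 0 := c.2
    rw [hνc, Prod.mk_eq_zero] at h0
    rw [LinearMap.mem_ker, Matrix.mulVecLin_apply, hψc]
    exact monskyMatrixOdd_mulVec_eq_zero hT hp hp2 hinj (c : W.selmerGroup 2).2 a b ha hb h0.1 h0.2
  let f : νS.ker → LinearMap.ker (monskyMatrixOdd p).mulVecLin := fun c => ⟨_, hkill c⟩
  have hf : Function.Injective f := by
    intro c₁ c₂ h12
    have h12' : ψ ((c₁ : W.selmerGroup 2) : galH1Torsion W 2) = ψ ((c₂ : W.selmerGroup 2) : galH1Torsion W 2) :=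
      congrArg Subtype.val h12
    set d : galH1Torsion W 2 := ((c₁ : W.selmerGroup 2) : galH1Torsion W 2) - ((c₂ : W.selmerGroup 2) : galH1Torsion W 2)
      with hd
    have hdS : d ∈ W.selmerGroup 2 := sub_mem (c₁ : W.selmerGroup 2).2 (c₂ : W.selmerGroup 2).2
    have hψd : ψ d = 0 := by rw [hd, map_sub, h12', sub_self]
    have hνd : ν d = 0 := by
      have h1 : ν ((c₁ : W.selmerGroup 2) : galH1Torsion W 2) = 0 := c₁.2
      have h2 : ν ((c₂ : W.selmerGroup 2) : galH1Torsion W 2) = 0 := c₂.2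
      rw [hd, map_sub, h1, h2, sub_zero]
    obtain ⟨a, b, ha, hb, hνc, hψc⟩ := hrep d
    rw [hνc, Prod.mk_eq_zero] at hνd
    rw [hψc] at hψd
    have hα : ∀ i, parityBit (p i) (a : ℚ) = 0 := fun i => congr_fun hψd (Sum.inl i)
    have hβ : ∀ i, parityBit (p i) (b : ℚ) = 0 := fun i => by
      have h := congr_fun hψd (Sum.inr i)
      simp only [Sum.elim_inr, Pi.zero_apply, hα i, zero_add] at h
      exact h
    have hd0 : d = 0 := eq_zero_of_coords_eq_zero hT hp hp2 hinj hdS a b ha hb hνd.1 hνd.2 hα hβ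
    exact Subtype.ext (Subtype.ext (sub_eq_zero.mp hd0))
  have hker : Nat.card νS.ker ≤ 2 ^ (2 * k - (monskyMatrixOdd p).rank) := by
    have := Nat.card_le_card_of_injective f hf
    rwa [natCard_ker_mulVecLin_eq, Fintype.card_sum, Fintype.card_fin, ← two_mul] at this
  calc Nat.card (W.selmerGroup 2) = Nat.card νS.ker * νS.ker.index := hmul.symm
    _ ≤ 2 ^ (2 * k - (monskyMatrixOdd p).rank) * 4 := Nat.mul_le_mul hker hidx
    _ = 2 ^ (2 + monskySelmerRankOdd p) := by rw [monskySelmerRankOdd, pow_add]; ring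

end CongruentNumberOddMonskySelmer

/-- **Monsky's `2`-Selmer formula, odd case, UPPER-BOUND HALF — for every `k`** (instance-free form, in the binders
of the named fact `HeathBrown1994.monsky_card_selmerGroup_two_odd`): for `p₁, …, p_k` distinct odd primes,
`#Sel⁽²⁾(E_{p₁⋯p_k}/ℚ) ≤ 2^{2 + s}`, `s = 2k − rank_{𝔽₂} M`, `M = ( A + D₂  D₂ ; D₂  A + D₋₂ )`. By complete `2`-descent on
Selmer classes (Silverman AEC X.1.4 / X.4.9 through the tree's descent–Selmer bridge). Unconditional; the `≥` half is NOT
claimed. [cite: HeathBrown1994SelmerCongruentII, Appendix (Monsky), typescript p. 38 L17 – p. 39 L33; §1 p. 1 L14–L20]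
[cite: SilvermanAEC2009, Prop. X.1.4, Prop. X.4.9] -/
theorem card_selmerGroup_two_le_pow_monskySelmerRankOdd (k : ℕ) (p : Fin k → ℕ)
    (hp : ∀ i, (p i).Prime) (hodd : ∀ i, Odd (p i)) (hinj : Function.Injective p) :
    Nat.card ((congruentNumberCurve (∏ i, p i)).selmerGroup 2) ≤ 2 ^ (2 + monskySelmerRankOdd p) :=
  CongruentNumberOddMonskySelmer.card_selmerGroup_two_le_pow hp
    (fun i h => Nat.not_even_iff_odd.mpr (hodd i) (h ▸ even_two)) hinj

end Literature.NumberTheory.EllipticCurves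

end
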